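/-
Copyright (c) 2026 the pub-hodgecm-mathlib formalisation cell (harness21).  Prover seat hodgecm-mathlib-K2E1-p12 (g0), Track B ∕ K2-LIT (build stream 29),
h413 = `stmt-HodgeConjecture-24833`, line `K2_E1_TraceFormulaBeta`, campaign «EIS-R7-BL» (Bernstein–Lapid soft continuation), dealer K2E1-plan (g6) rulings (56)∕(58)∕(64)∕(67)
2026-09-04T10:16:42Z–10:24:18Z («THE TWO S-BRICKS», S-α half): THE `pZX` A.E.-TRANSPORT `Z_{c₀} → 𝔛` AND THE SIEGEL HEIGHT MATCH — EVERY RANK, with `N = 2, 3` corollaries.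
Spec bytes = K2E2-p12 (g5)'s census 10:18:56Z (`hZX_up` ∕ `hZX_down` ∕ `hHZ`); consumer: K2E4-p11 (g5)'s operator road (66)(O2) (letter `hZX`).
-/
import Summits.HodgeConjecture.HodgeConjecture.Theorems.K2E1BLIotaUnfoldingU                        -- ★ (K2E1-p08) `exists_forall_mul_lintegral_comp_pZX_eq` (the unfolding of `p : Z_c → 𝔛`, every rank), `measurable_pZX`, `borelHeight_arithmeticBorel_mul'`
import Summits.HodgeConjecture.HodgeConjecture.Theorems.K2E1BLHeckeOperatorHXU2                      -- ★ (K2E1-p11) rank-`N` `supHeight_toAutomorphicQuotient`, `supHeight_pos`, `measurable_supHeight`, `measurable_weightX`; brings ★ `bddAbove_range_borelHeight_arith_mul`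
import Summits.HodgeConjecture.HodgeConjecture.Theorems.K2E1BLEisensteinInWeightedSpaceU2Weights   -- ★ (K2E4-p23) rank-`N` `supHeight_eq_ciSup_arithmetic` (`w₁ x = ⨆_{γ ∈ G(F)} H(γ·x̃⁻¹)` at the LITERAL representative `x̃ = x.out`)
import Summits.HodgeConjecture.HodgeConjecture.Theorems.K2E1TruncatedCuspCompactU2                   -- ★ K2 (K2E4-p23) rank-`N` `ae_lt_borelQuotHeight_weightedTruncMeasure` (`c₀ < HZ` a.e. for `wtm_{k,c₀}`)
import Literature.NumberTheory.Automorphic.UnitaryGroupBorelHeightBigCell                            -- ★ Siegel `N = 3`: `borelHeight_mul_lt_one_of_not_mem_arithmeticBorel`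
import Literature.NumberTheory.Automorphic.UnitaryGroupBorelHeightBigCellTwo                         -- ★ Siegel `N = 2`: `borelHeight_mul_lt_one_of_not_mem_arithmeticBorel_two`
import HarnessLib

/-!
# K2·E1 — `K2E1BLSiegelTransportU` (S-BRICK (S-α), EVERY RANK `N`): TRANSPORT OF NULL SETS AND A.E. STATEMENTS ALONG `p : Z = B(F)∖G(𝔸) → 𝔛 = G(F)∖G(𝔸)` BETWEEN THE TRUNCATED
# WEIGHTED MEASURE `HZ^{−2k}μZ|_{Z_{c₀}}` AND `μ|_{{c₀ < w₁}}`, AND THE SIEGEL HEIGHT MATCH `w₁(p z) = HZ(z)` ON `Z_1`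

Track B ∕ K2-LIT, crux h413 = `stmt-HodgeConjecture-24833`, route of record `HCCMUnconditional`; cell `hodgecm-mathlib`, squad K2, ENGINE E1 (campaign «EIS-R7-BL»).  Dealer K2E1-plan (g6)
rulings (56)∕(58)∕(64)∕(67) «the two S-bricks; (S-α) = K2E1-p12, rank-generic `K2E1BLSiegelTransportU` with cm∕rank specialisations as §-corollaries; bytes = K2E2-p12 (g5)'s census».
THEOREMS ONLY (no `def`, no `instance`, no notation, no named-fact hypothesis, no `sorry`; default heartbeats); lane `--kind proof --supports stmt-HodgeConjecture-24833 --as helper`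
(count-neutral).  SETTING (★ leaves 1–2, every rank): `Z = B(F)∖G(𝔸)` (`borelQuotient`), `HZ` its height, `wtm_{k,c₀} = HZ^{−2k}·μZ|_{Z_{c₀}}` (`weightedTruncMeasure`), `𝔛 = G(F)∖G(𝔸)`
(`automorphicQuotient`, automorphic measure `μ`), `w₁ = supHeight`, `p = pZX : Z → 𝔛`, `B(F)·g ↦ [g⁻¹]`, and the unfolding pair `(hβ, hμZ)` of ★ `K2E1BLIotaUnfoldingU`.

THE MATHEMATICS [BernsteinLapid2019, §4 Claim 4 (p. 10); Borel1963, §5; MoeglinWaldspurger1995, I.2.1; Garrett2018, §1.5].  Everything rides on ONE ★ identity, the every-rank unfolding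
★ `exists_forall_mul_lintegral_comp_pZX_eq`: `C · ∫⁻_Z Φ(p z) d(wtm_{k,c₀}) = ∫⁻_𝔛 Φ(x) · Σ'_{q ∈ B(F)∖G(F)} 𝟙_{c₀ < H(q̃ x̃⁻¹)} H(q̃ x̃⁻¹)^{−2k} dμ(x)` (`C ≠ 0, ∞`).  With `Φ = 𝟙_S`:
(UP) `μ S = 0 ⇒ wtm(p⁻¹ S) = 0` — `p` is quasi-measure-preserving `(Z, wtm) → (𝔛, μ)` for EVERY `c₀` (no Siegel, no reduction theory); (DOWN) `wtm(p⁻¹ S) = 0 ⇒ μ(S ∩ {c₀ < w₁}) = 0`,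
because on `{c₀ < w₁ x}` SOME coset has `H(q̃ x̃⁻¹) > c₀` (`w₁ x = ⨆_γ H(γ x̃⁻¹)`, `lt_ciSup` — no attainment needed) and contributes `≥ w₁(x)^{−2k} > 0` to the fibre sum.  Hence a.e.
statements pulled back from `𝔛` transport both ways (DOWN for measurable predicates).  The SIEGEL HEIGHT MATCH: `HZ(z) ≤ w₁(p z)` always (`γ = 1`), and for `HZ(z) > 1` equality holds,
since `H(γ g) = H(g)` for `γ ∈ B(F)` and `H(γ g) < 1` for `γ ∉ B(F)` (★ big cell `H(γg)·H(g) ≤ 1`, `N = 2, 3`; carried as the binder `hSieg` at rank `N` and DISCHARGED at `N = 2, 3`); so on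
`Z_{c₀}`, `c₀ ≥ 1`, statements in `HZ z` and in `w₁(p z)` are interchangeable a.e., which gives the dealer's shape `(∀ᵐ z ∂wtm, P (HZ z) (p z)) ↔ (∀ᵐ x ∂μ|_{c₀<w₁}, P (w₁ x) x)`.

* §1 (heights, every rank) `borelHeight_out_mk_mul'` (coset representatives), `supHeight_pZX_toBorelQuotient`, **`borelQuotHeight_le_supHeight_pZX`**, **`supHeight_pZX_eq_of_one_lt`** (on the
  binder `hSieg`), its a.e. form `ae_supHeight_pZX_eq` on `wtm_{k,c₀}`, `1 ≤ c₀`; and the DISCHARGED heads **`supHeight_pZX_eq_of_one_lt_two`** ∕ **`_three`**, `ae_supHeight_pZX_eq_two` ∕ `_three`.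
* §2 (UP, every rank, every `c₀`) **`measure_preimage_pZX_eq_zero`** (= `hZX_up`), **`quasiMeasurePreserving_pZX`**, **`ae_comp_pZX_of_ae`**: `(∀ᵐ x ∂μ, Q x) → ∀ᵐ z ∂wtm_{k,c₀}, Q (p z)`.
* §3 (DOWN, every rank, every `c₀`) **`measure_inter_eq_zero_of_measure_preimage_pZX_eq_zero`** (= `hZX_down`), **`ae_restrict_of_ae_comp_pZX`**: for measurable `{x | Q x}`,
  `(∀ᵐ z ∂wtm_{k,c₀}, Q (p z)) → ∀ᵐ x ∂μ|_{{c₀ < w₁}}, Q x`.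
* §4 (the dealer's shape, `1 ≤ c₀`, binder `hSieg`) **`ae_weightedTruncMeasure_of_ae_restrict`** and **`ae_restrict_of_ae_weightedTruncMeasure`** for predicates `P (height) (point)`, and the
  DISCHARGED `_two` ∕ `_three` editions.
HONEST LABEL: HC_CM is proved only modulo the 7 printed citations (2 remaining named inputs: hLiu418 = `stmt-HodgeConjecture-24832`, h413 = `stmt-HodgeConjecture-24833`) until rung 0
closes; this file asserts no named fact, closes no socket and crosses no ceiling by itself; count-neutral.

## References
* [BernsteinLapid2019] J. Bernstein, E. Lapid, *On the meromorphic continuation of Eisenstein series*, J. Amer. Math. Soc. 37 (2024) (arXiv:1911.02342), §4 Claim 4 (p. 10).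
* [Borel1963] A. Borel, *Some finiteness properties of adele groups over number fields*, Publ. Math. IHÉS 16 (1963), §5.
* [MoeglinWaldspurger1995] C. Mœglin, J.-L. Waldspurger, *Spectral Decomposition and Eisenstein Series* (1995), I.2.1 (Siegel domains).
* [Garrett2018] P. Garrett, *Modern Analysis of Automorphic Forms by Example* (2018), §1.5, §2.3 (at most one translate is high in the cusp).
-/

set_option autoImplicit false
-- the mandated namespace repeats `HodgeConjecture.HodgeConjecture`, as in every `Theorems/*.lean` of this sub-problem
set_option linter.dupNamespace false

noncomputable section

open MeasureTheory MeasureTheory.Measure Set NumberField IsDedekindDomain Filter Topology Function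
open scoped NNReal ENNReal
open Literature.MeasureTheory.Group Literature.NumberTheory.Automorphic Literature.NumberTheory.Automorphic.UnitaryGroup AdelicGroupData
open Summit.HodgeConjecture.HodgeConjecture.Cruxes.H413.K2E1BLBorelSpacesU2Defs
open Summit.HodgeConjecture.HodgeConjecture.Cruxes.H413.K2E1BLIotaUnfoldingU (exists_forall_mul_lintegral_comp_pZX_eq measurable_pZX borelHeight_arithmeticBorel_mul' measurable_borelQuotHeight)
open Summit.HodgeConjecture.HodgeConjecture.Cruxes.H413.K2E1BLHeckeOperatorHXU2 (supHeight_toAutomorphicQuotient supHeight_pos measurable_supHeight measurable_weightX)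
open Summit.HodgeConjecture.HodgeConjecture.Cruxes.H413.K2E1BLHeckeOperatorWeightedU2 (bddAbove_range_borelHeight_arith_mul)
open Summit.HodgeConjecture.HodgeConjecture.Cruxes.H413.K2E1BLEisensteinInWeightedSpaceU2Weights (supHeight_eq_ciSup_arithmetic)
open Summit.HodgeConjecture.HodgeConjecture.Cruxes.H413.K2E1TruncatedCuspCompactU2 (ae_lt_borelQuotHeight_weightedTruncMeasure)

namespace Summit.HodgeConjecture.HodgeConjecture.Cruxes.H413.K2E1BLSiegelTransportU

variable {F E : Type} [Field F] [NumberField F] [Field E] [NumberField E] [Algebra F E] {c : E ≃ₐ[F] E} {N : ℕ} [NeZero N]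

/-! ## §1 Heights on `Z` versus `𝔛`: `HZ(z) ≤ w₁(p z)`, with equality on `Z_1` (Siegel) -/

section Heights

omit [NeZero N] in
/-- The height at the ★ `pseudoEisenstein` representative of the coset `B(F)δ`: **`H(⟦δ⟧.out · x) = H(δ · x)`** (every rank; `⟦δ⟧.out = b·δ`, `b ∈ B(F)`, and `H` is left-`B(F)`-invariant ★;
rank-`N` twin of ★ `borelHeight_out_mk_mul` ∕ `_two`). [cite: BernsteinLapid2019, §4 (p. 10)] -/
theorem borelHeight_out_mk_mul' [NeZero N] (δ : (quasiSplit F E c N).arithmeticSubgroup) (x : (quasiSplit F E c N).Adelic) :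
    borelHeight ((((Quotient.mk (QuotientGroup.rightRel (arithmeticBorel F E c N)) δ).out :
        (quasiSplit F E c N).arithmeticSubgroup) : (quasiSplit F E c N).Adelic) * x) =
      borelHeight (((δ : (quasiSplit F E c N).arithmeticSubgroup) : (quasiSplit F E c N).Adelic) * x) := by
  set o := (Quotient.mk (QuotientGroup.rightRel (arithmeticBorel F E c N)) δ).out with ho
  have h : δ * o⁻¹ ∈ arithmeticBorel F E c N := by
    have h1 : Quotient.mk (QuotientGroup.rightRel (arithmeticBorel F E c N)) o =
        Quotient.mk (QuotientGroup.rightRel (arithmeticBorel F E c N)) δ := Quotient.out_eq _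
    exact QuotientGroup.rightRel_apply.1 (Quotient.eq.1 h1)
  have e : (((δ : (quasiSplit F E c N).arithmeticSubgroup) : (quasiSplit F E c N).Adelic) * x) =
      (((δ * o⁻¹ : (quasiSplit F E c N).arithmeticSubgroup)) : (quasiSplit F E c N).Adelic) *
        ((((o : (quasiSplit F E c N).arithmeticSubgroup)) : (quasiSplit F E c N).Adelic) * x) := by
    simp only [Subgroup.coe_mul, Subgroup.coe_inv, mul_assoc, inv_mul_cancel_left]
  rw [e, borelHeight_arithmeticBorel_mul' h]

/-- **`w₁(p(π g)) = ⨆_{γ ∈ G(F)} H(γ g)`** (`p(π g) = [g⁻¹]`, ★ rank-`N` `supHeight_toAutomorphicQuotient`, `(g⁻¹)⁻¹ = g`). [cite: BernsteinLapid2019, §4 Claim 4 (p. 10)] -/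
theorem supHeight_pZX_toBorelQuotient (g : (quasiSplit F E c N).Adelic) :
    supHeight F E c N (pZX F E c N (toBorelQuotient F E c N g)) = ⨆ γ : (quasiSplit F E c N).arithmeticSubgroup, borelHeight ((γ : (quasiSplit F E c N).Adelic) * g) := by
  rw [pZX_toBorelQuotient, supHeight_toAutomorphicQuotient, inv_inv]

/-- **`HZ(z) ≤ w₁(p z)`** for every `z ∈ Z` (the coset `B(F)·1` contributes `H(g)` to the supremum; every rank, every height). [cite: BernsteinLapid2019, §4 Claim 4 (p. 10)] -/
theorem borelQuotHeight_le_supHeight_pZX (z : borelQuotient F E c N) : borelQuotHeight F E c N z ≤ supHeight F E c N (pZX F E c N z) := by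
  induction z using Quotient.inductionOn with
  | h g =>
    change borelQuotHeight F E c N (toBorelQuotient F E c N g) ≤ supHeight F E c N (pZX F E c N (toBorelQuotient F E c N g))
    rw [borelQuotHeight_toBorelQuotient, supHeight_pZX_toBorelQuotient]
    have h := le_ciSup (bddAbove_range_borelHeight_arith_mul g) (1 : (quasiSplit F E c N).arithmeticSubgroup)
    rwa [OneMemClass.coe_one, one_mul] at h

/-- **THE SIEGEL HEIGHT MATCH `w₁(p z) = HZ(z)` ON `Z_1`** (every rank, on the binder `hSieg` = «at most one translate is high»: `γ ∉ B(F)`, `H(g) > 1 ⇒ H(γ g) < 1` — ★ at `N = 2, 3`, the big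
cell): for `HZ(z) > 1` every `B(F)`-translate has the same height and every other translate is below `1 < HZ(z)`. [cite: Garrett2018, §1.5 and §2.3] [cite: Borel1963, §5] -/
theorem supHeight_pZX_eq_of_one_lt
    (hSieg : ∀ γ : (quasiSplit F E c N).arithmeticSubgroup, γ ∉ arithmeticBorel F E c N → ∀ g : (quasiSplit F E c N).Adelic,
      1 < borelHeight g → borelHeight ((γ : (quasiSplit F E c N).Adelic) * g) < 1)
    {z : borelQuotient F E c N} (hz : 1 < borelQuotHeight F E c N z) : supHeight F E c N (pZX F E c N z) = borelQuotHeight F E c N z := by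
  refine le_antisymm ?_ (borelQuotHeight_le_supHeight_pZX z)
  induction z using Quotient.inductionOn with
  | h g =>
    change 1 < borelQuotHeight F E c N (toBorelQuotient F E c N g) at hz
    change supHeight F E c N (pZX F E c N (toBorelQuotient F E c N g)) ≤ borelQuotHeight F E c N (toBorelQuotient F E c N g)
    rw [borelQuotHeight_toBorelQuotient] at hz ⊢
    rw [supHeight_pZX_toBorelQuotient]
    refine ciSup_le fun γ => ?_
    by_cases hγ : γ ∈ arithmeticBorel F E c N
    · exact (borelHeight_arithmeticBorel_mul' hγ g).le
    · exact ((hSieg γ hγ g hz).trans hz).le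

/-- **A.E. ON `Z_{c₀}`, `c₀ ≥ 1`: `w₁(p z) = HZ(z)`** for the truncated weighted measure `wtm_{k,c₀}` (★ `c₀ < HZ` a.e. + §1), on the binder `hSieg`. [cite: Garrett2018, §2.3] [cite: BernsteinLapid2019, §4 (p. 10)] -/
theorem ae_supHeight_pZX_eq
    (hSieg : ∀ γ : (quasiSplit F E c N).arithmeticSubgroup, γ ∉ arithmeticBorel F E c N → ∀ g : (quasiSplit F E c N).Adelic,
      1 < borelHeight g → borelHeight ((γ : (quasiSplit F E c N).Adelic) * g) < 1)
    (k : ℕ) {c₀ : ℝ≥0} (hc₀ : 1 ≤ c₀) (μZ : Measure (borelQuotient F E c N)) :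
    ∀ᵐ z ∂(weightedTruncMeasure F E c N k c₀ μZ), supHeight F E c N (pZX F E c N z) = borelQuotHeight F E c N z :=
  (ae_lt_borelQuotHeight_weightedTruncMeasure k c₀ μZ).mono fun _ hz => supHeight_pZX_eq_of_one_lt hSieg (hc₀.trans_lt hz)

end Heights

/-! ### §1′ The Siegel binder discharged at `N = 2` and `N = 3` (★ big cell `H(γ g)·H(g) ≤ 1` off `B(F)`) -/

section HeightsTwoThree

variable {F E : Type} [Field F] [NumberField F] [Field E] [NumberField E] [Algebra F E] {c : E ≃ₐ[F] E}

/-- `N = 2`: **`w₁(p z) = HZ(z)` for `HZ(z) > 1`**, letter-free (★ `borelHeight_mul_lt_one_of_not_mem_arithmeticBorel_two`). [cite: Garrett2018, §1.5 and §2.3] -/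
theorem supHeight_pZX_eq_of_one_lt_two {z : borelQuotient F E c 2} (hz : 1 < borelQuotHeight F E c 2 z) : supHeight F E c 2 (pZX F E c 2 z) = borelQuotHeight F E c 2 z :=
  supHeight_pZX_eq_of_one_lt (fun _ hγ _ hg => borelHeight_mul_lt_one_of_not_mem_arithmeticBorel_two hγ hg) hz

/-- `N = 3`: **`w₁(p z) = HZ(z)` for `HZ(z) > 1`**, letter-free (★ `borelHeight_mul_lt_one_of_not_mem_arithmeticBorel`). [cite: Garrett2018, §1.5 and §2.3] [cite: Rogawski1990, §2.2 p. 13] -/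
theorem supHeight_pZX_eq_of_one_lt_three {z : borelQuotient F E c 3} (hz : 1 < borelQuotHeight F E c 3 z) : supHeight F E c 3 (pZX F E c 3 z) = borelQuotHeight F E c 3 z :=
  supHeight_pZX_eq_of_one_lt (fun _ hγ _ hg => borelHeight_mul_lt_one_of_not_mem_arithmeticBorel hγ hg) hz

/-- `N = 2`, a.e. on `Z_{c₀}`, `c₀ ≥ 1`: `w₁(p z) = HZ(z)`. [cite: Garrett2018, §2.3] -/
theorem ae_supHeight_pZX_eq_two (k : ℕ) {c₀ : ℝ≥0} (hc₀ : 1 ≤ c₀) (μZ : Measure (borelQuotient F E c 2)) :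
    ∀ᵐ z ∂(weightedTruncMeasure F E c 2 k c₀ μZ), supHeight F E c 2 (pZX F E c 2 z) = borelQuotHeight F E c 2 z :=
  ae_supHeight_pZX_eq (fun _ hγ _ hg => borelHeight_mul_lt_one_of_not_mem_arithmeticBorel_two hγ hg) k hc₀ μZ

/-- `N = 3`, a.e. on `Z_{c₀}`, `c₀ ≥ 1`: `w₁(p z) = HZ(z)`. [cite: Garrett2018, §2.3] [cite: Rogawski1990, §2.2 p. 13] -/
theorem ae_supHeight_pZX_eq_three (k : ℕ) {c₀ : ℝ≥0} (hc₀ : 1 ≤ c₀) (μZ : Measure (borelQuotient F E c 3)) :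
    ∀ᵐ z ∂(weightedTruncMeasure F E c 3 k c₀ μZ), supHeight F E c 3 (pZX F E c 3 z) = borelQuotHeight F E c 3 z :=
  ae_supHeight_pZX_eq (fun _ hγ _ hg => borelHeight_mul_lt_one_of_not_mem_arithmeticBorel hγ hg) k hc₀ μZ

end HeightsTwoThree

/-! ## §2 UP: `μ`-null sets pull back to `wtm_{k,c₀}`-null sets (every rank, every `c₀`) -/

section Transport

variable [MeasurableSpace (quasiSplit F E c N).Adelic] [BorelSpace (quasiSplit F E c N).Adelic]
  (μ : Measure (quasiSplit F E c N).automorphicQuotient) [(quasiSplit F E c N).IsAutomorphicMeasure μ]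
  (νG : Measure (quasiSplit F E c N).Adelic) [νG.IsHaarMeasure] [νG.IsInvInvariant]
  {β : (quasiSplit F E c N).Adelic → ℝ≥0∞} (hβ : IsCoveringWeight ↥((arithmeticBorel F E c N).map (quasiSplit F E c N).arithmeticSubgroup.subtype) β)
  {μZ : Measure (borelQuotient F E c N)}
  (hμZ : ∀ f : borelQuotient F E c N → ℝ≥0∞, Measurable f → ∫⁻ z, f z ∂μZ = ∫⁻ g, β g * f (toBorelQuotient F E c N g) ∂νG)

omit [MeasurableSpace (quasiSplit F E c N).Adelic] [BorelSpace (quasiSplit F E c N).Adelic] in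
/-- The pulled-back indicator integral is the measure of the preimage: `∫⁻_Z 𝟙_S(p z) d(wtm) = wtm(p⁻¹ S)`. [cite: BernsteinLapid2019, §4 Claim 4 (p. 10)] -/
theorem lintegral_indicator_one_comp_pZX (k : ℕ) (c₀ : ℝ≥0) {S : Set (quasiSplit F E c N).automorphicQuotient} (hS : MeasurableSet S) :
    ∫⁻ z, S.indicator 1 (pZX F E c N z) ∂(weightedTruncMeasure F E c N k c₀ μZ) = weightedTruncMeasure F E c N k c₀ μZ (pZX F E c N ⁻¹' S) := by
  rw [← lintegral_indicator_one (measurable_pZX hS)]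
  rfl

omit [NeZero N] [MeasurableSpace (quasiSplit F E c N).Adelic] [BorelSpace (quasiSplit F E c N).Adelic] [(quasiSplit F E c N).IsAutomorphicMeasure μ] in
/-- An integrand supported in a `μ`-null set integrates to zero (no measurability needed). [folklore] -/
theorem lintegral_indicator_one_mul_eq_zero {S : Set (quasiSplit F E c N).automorphicQuotient} (h0 : μ S = 0) (f : (quasiSplit F E c N).automorphicQuotient → ℝ≥0∞) :
    ∫⁻ x, S.indicator 1 x * f x ∂μ = 0 := by
  have hae : ∀ᵐ x ∂μ, S.indicator (1 : (quasiSplit F E c N).automorphicQuotient → ℝ≥0∞) x * f x = 0 := by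
    refine ae_iff.2 (measure_mono_null (fun x hx => ?_) h0)
    by_contra hxS
    exact hx (by rw [Set.indicator_of_notMem hxS, zero_mul])
  rw [lintegral_congr_ae hae, lintegral_zero]

include hβ hμZ in
/-- **UP (`hZX_up`): `μ S = 0 ⇒ wtm_{k,c₀}(p⁻¹ S) = 0`** for Borel `S ⊆ 𝔛` — EVERY rank and EVERY `c₀` (no Siegel, no reduction theory): the unfolding ★ `exists_forall_mul_lintegral_comp_pZX_eq` with
`Φ = 𝟙_S` reads `C · wtm(p⁻¹ S) = ∫⁻_S (fibre sum) dμ = 0`, `C ≠ 0`. [cite: BernsteinLapid2019, §4 Claim 4 (p. 10)] [cite: MoeglinWaldspurger1995, I.2.1] -/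
theorem measure_preimage_pZX_eq_zero (k : ℕ) (c₀ : ℝ≥0) {S : Set (quasiSplit F E c N).automorphicQuotient} (hS : MeasurableSet S) (h0 : μ S = 0) :
    weightedTruncMeasure F E c N k c₀ μZ (pZX F E c N ⁻¹' S) = 0 := by
  obtain ⟨C, hC0, -, hunf⟩ := exists_forall_mul_lintegral_comp_pZX_eq μ νG hβ hμZ
  have hkey := hunf k c₀ (S.indicator 1) (measurable_one.indicator hS)
  rw [lintegral_indicator_one_comp_pZX k c₀ hS] at hkey
  exact (mul_eq_zero.1 (hkey.trans (lintegral_indicator_one_mul_eq_zero μ h0 _))).resolve_left hC0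

include hβ hμZ in
/-- **`p : (Z, wtm_{k,c₀}) → (𝔛, μ)` IS QUASI-MEASURE-PRESERVING** (every rank, every `c₀`; target `μ` itself — ★ `quasiMeasurePreserving_pZX_cm[_three]` target `μ·w₁^{−2k}`, same null sets).
[cite: BernsteinLapid2019, §4 Claim 4 (p. 10)] -/
theorem quasiMeasurePreserving_pZX (k : ℕ) (c₀ : ℝ≥0) :
    QuasiMeasurePreserving (pZX F E c N) (weightedTruncMeasure F E c N k c₀ μZ) μ := by
  refine ⟨measurable_pZX, Measure.AbsolutelyContinuous.mk fun S hS h0 => ?_⟩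
  rw [Measure.map_apply measurable_pZX hS]
  exact measure_preimage_pZX_eq_zero μ νG hβ hμZ k c₀ hS h0

include hβ hμZ in
/-- **UP, a.e. form: `(∀ᵐ x ∂μ, Q x) → ∀ᵐ z ∂wtm_{k,c₀}, Q (p z)`** — any predicate `Q` on `𝔛`, every rank, every `c₀`. [cite: BernsteinLapid2019, §4 Claim 4 (p. 10)] -/
theorem ae_comp_pZX_of_ae (k : ℕ) (c₀ : ℝ≥0) {Q : (quasiSplit F E c N).automorphicQuotient → Prop} (h : ∀ᵐ x ∂μ, Q x) :
    ∀ᵐ z ∂(weightedTruncMeasure F E c N k c₀ μZ), Q (pZX F E c N z) :=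
  (quasiMeasurePreserving_pZX μ νG hβ hμZ k c₀).ae h

/-! ## §3 DOWN: `wtm_{k,c₀}`-null preimages come from `μ`-null sets on `{c₀ < w₁}` (every rank, every `c₀`) -/

include hβ hμZ in
/-- **DOWN (`hZX_down`): `wtm_{k,c₀}(p⁻¹ S) = 0 ⇒ μ(S ∩ {c₀ < w₁}) = 0`** for Borel `S ⊆ 𝔛` — EVERY rank and EVERY `c₀`: by the unfolding, `∫⁻_S (fibre sum) dμ = C·0 = 0`; on `{c₀ < w₁ x}` some
coset has `H(γ x̃⁻¹) > c₀` (`w₁ x = ⨆_γ H(γ x̃⁻¹)`, ★ `supHeight_eq_ciSup_arithmetic`, `lt_ciSup` — no attainment needed) and contributes `≥ w₁(x)^{−2k} > 0`, so the fibre sum is bounded below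
by the MEASURABLE positive weight `𝟙_{S ∩ {c₀<w₁}} · w₁^{−2k}` (★ `measurable_weightX`), whose integral then vanishes. [cite: BernsteinLapid2019, §4 Claim 4 (p. 10)] [cite: Borel1963, §5] -/
theorem measure_inter_eq_zero_of_measure_preimage_pZX_eq_zero (k : ℕ) (c₀ : ℝ≥0) {S : Set (quasiSplit F E c N).automorphicQuotient} (hS : MeasurableSet S)
    (h0 : weightedTruncMeasure F E c N k c₀ μZ (pZX F E c N ⁻¹' S) = 0) :
    μ (S ∩ {x | c₀ < supHeight F E c N x}) = 0 := by
  obtain ⟨C, -, -, hunf⟩ := exists_forall_mul_lintegral_comp_pZX_eq μ νG hβ hμZ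
  have hkey := hunf k c₀ (S.indicator 1) (measurable_one.indicator hS)
  rw [lintegral_indicator_one_comp_pZX k c₀ hS, h0, mul_zero] at hkey
  -- the measurable positive minorant `𝟙_{S ∩ T} · w₁^{−2k}`
  set T : Set (quasiSplit F E c N).automorphicQuotient := {x | c₀ < supHeight F E c N x} with hT
  have hTm : MeasurableSet T := measurableSet_lt measurable_const measurable_supHeight
  set w : (quasiSplit F E c N).automorphicQuotient → ℝ≥0∞ := fun x => ((((supHeight F E c N x)⁻¹ ^ (2 * k) : ℝ≥0)) : ℝ≥0∞) with hw
  have hwm : Measurable w := measurable_weightX k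
  have hwpos : ∀ x, w x ≠ 0 := fun x => ENNReal.coe_ne_zero.2 (pow_ne_zero _ (inv_ne_zero (supHeight_pos x).ne'))
  have hle : ∀ x, (S ∩ T).indicator w x ≤ S.indicator 1 x * ∑' q : Quotient (QuotientGroup.rightRel (arithmeticBorel F E c N)),
      {y : (quasiSplit F E c N).Adelic | c₀ < borelHeight y}.indicator (fun y => (((borelHeight y)⁻¹ ^ (2 * k) : ℝ≥0) : ℝ≥0∞))
        (((q.out : (quasiSplit F E c N).arithmeticSubgroup) : (quasiSplit F E c N).Adelic) *
          (Quotient.out x : (quasiSplit F E c N).Adelic)⁻¹) := by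
    intro x
    by_cases hxST : x ∈ S ∩ T
    · obtain ⟨hxS, hxT⟩ := hxST
      rw [Set.indicator_of_mem (Set.mem_inter hxS hxT), Set.indicator_of_mem hxS, Pi.one_apply, one_mul]
      have hsup := supHeight_eq_ciSup_arithmetic x
      have hxT' : c₀ < ⨆ γ : (quasiSplit F E c N).arithmeticSubgroup,
          borelHeight ((γ : (quasiSplit F E c N).Adelic) * (Quotient.out (x : (quasiSplit F E c N).Adelic ⧸ (quasiSplit F E c N).quotientSubgroup))⁻¹) := by
        rw [← hsup]; exact hxT
      obtain ⟨γ, hγ⟩ := (lt_ciSup_iff (bddAbove_range_borelHeight_arith_mul _)).1 hxT'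
      refine le_trans ?_ (ENNReal.le_tsum (Quotient.mk (QuotientGroup.rightRel (arithmeticBorel F E c N)) γ))
      have hH := borelHeight_out_mk_mul' γ (Quotient.out (x : (quasiSplit F E c N).Adelic ⧸ (quasiSplit F E c N).quotientSubgroup))⁻¹
      have hmem : (((Quotient.mk (QuotientGroup.rightRel (arithmeticBorel F E c N)) γ).out : (quasiSplit F E c N).arithmeticSubgroup) : (quasiSplit F E c N).Adelic) *
          (Quotient.out (x : (quasiSplit F E c N).Adelic ⧸ (quasiSplit F E c N).quotientSubgroup))⁻¹ ∈ {y : (quasiSplit F E c N).Adelic | c₀ < borelHeight y} := by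
        rw [Set.mem_setOf_eq, hH]; exact hγ
      rw [Set.indicator_of_mem hmem, hH]
      have hle' : borelHeight ((γ : (quasiSplit F E c N).Adelic) * (Quotient.out (x : (quasiSplit F E c N).Adelic ⧸ (quasiSplit F E c N).quotientSubgroup))⁻¹) ≤
          supHeight F E c N x := by
        rw [hsup]; exact le_ciSup (bddAbove_range_borelHeight_arith_mul _) γ
      exact ENNReal.coe_le_coe.2 (pow_le_pow_left₀ zero_le (inv_anti₀ (borelHeight_pos _) hle') _)
    · rw [Set.indicator_of_notMem hxST]; exact zero_le
  have hint : ∫⁻ x, (S ∩ T).indicator w x ∂μ = 0 := le_antisymm ((lintegral_mono hle).trans (le_of_eq hkey.symm)) zero_le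
  have hae := (lintegral_eq_zero_iff (hwm.indicator (hS.inter hTm))).1 hint
  refine measure_mono_null (fun x hxST => ?_) (ae_iff.1 hae)
  show ¬ ((S ∩ T).indicator w x = (0 : (quasiSplit F E c N).automorphicQuotient → ℝ≥0∞) x)
  rw [Pi.zero_apply, Set.indicator_of_mem hxST]
  exact hwpos x

include hβ hμZ in
/-- **DOWN, a.e. form: `(∀ᵐ z ∂wtm_{k,c₀}, Q (p z)) → ∀ᵐ x ∂μ|_{{c₀ < w₁}}, Q x`** for MEASURABLE `{x | Q x}` — every rank, every `c₀`. [cite: BernsteinLapid2019, §4 Claim 4 (p. 10)] -/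
theorem ae_restrict_of_ae_comp_pZX (k : ℕ) (c₀ : ℝ≥0) {Q : (quasiSplit F E c N).automorphicQuotient → Prop} (hQ : MeasurableSet {x | Q x})
    (h : ∀ᵐ z ∂(weightedTruncMeasure F E c N k c₀ μZ), Q (pZX F E c N z)) :
    ∀ᵐ x ∂(μ.restrict {x | c₀ < supHeight F E c N x}), Q x := by
  have hTm : MeasurableSet {x : (quasiSplit F E c N).automorphicQuotient | c₀ < supHeight F E c N x} := measurableSet_lt measurable_const measurable_supHeight
  have h0 : weightedTruncMeasure F E c N k c₀ μZ (pZX F E c N ⁻¹' {x | ¬ Q x}) = 0 := ae_iff.1 h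
  have h1 := measure_inter_eq_zero_of_measure_preimage_pZX_eq_zero μ νG hβ hμZ k c₀ hQ.compl h0
  rw [ae_restrict_iff' hTm]
  refine ae_iff.2 (measure_mono_null (fun x hx => ?_) h1)
  have hx' : ¬ (c₀ < supHeight F E c N x → Q x) := hx
  rw [Classical.not_imp] at hx'
  exact ⟨hx'.2, hx'.1⟩

/-! ## §4 The dealer's shape on `Z_{c₀}`, `c₀ ≥ 1`: statements in `HZ` on `Z` ↔ statements in `w₁` on `𝔛` (binder `hSieg`; discharged at `N = 2, 3` below) -/

include hβ hμZ in
/-- **`𝔛 → Z` WITH HEIGHTS: `(∀ᵐ x ∂μ|_{{c₀<w₁}}, P (w₁ x) x) → ∀ᵐ z ∂wtm_{k,c₀}, P (HZ z) (p z)`** (`c₀ ≥ 1`, binder `hSieg`; UP §2 + the Siegel height match §1 a.e.). [cite: BernsteinLapid2019, §4 (p. 10)]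
[cite: Garrett2018, §2.3] -/
theorem ae_weightedTruncMeasure_of_ae_restrict
    (hSieg : ∀ γ : (quasiSplit F E c N).arithmeticSubgroup, γ ∉ arithmeticBorel F E c N → ∀ g : (quasiSplit F E c N).Adelic,
      1 < borelHeight g → borelHeight ((γ : (quasiSplit F E c N).Adelic) * g) < 1)
    (k : ℕ) {c₀ : ℝ≥0} (hc₀ : 1 ≤ c₀) {P : ℝ≥0 → (quasiSplit F E c N).automorphicQuotient → Prop}
    (h : ∀ᵐ x ∂(μ.restrict {x | c₀ < supHeight F E c N x}), P (supHeight F E c N x) x) :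
    ∀ᵐ z ∂(weightedTruncMeasure F E c N k c₀ μZ), P (borelQuotHeight F E c N z) (pZX F E c N z) := by
  have hTm : MeasurableSet {x : (quasiSplit F E c N).automorphicQuotient | c₀ < supHeight F E c N x} := measurableSet_lt measurable_const measurable_supHeight
  have h1 := ae_comp_pZX_of_ae μ νG hβ hμZ k c₀ ((ae_restrict_iff' hTm).1 h)
  filter_upwards [h1, ae_lt_borelQuotHeight_weightedTruncMeasure k c₀ μZ, ae_supHeight_pZX_eq hSieg k hc₀ μZ] with z hz hlt heq
  rw [← heq]
  exact hz (show c₀ < supHeight F E c N (pZX F E c N z) by rw [heq]; exact hlt)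

include hβ hμZ in
/-- **`Z → 𝔛` WITH HEIGHTS: `(∀ᵐ z ∂wtm_{k,c₀}, P (HZ z) (p z)) → ∀ᵐ x ∂μ|_{{c₀<w₁}}, P (w₁ x) x`** for MEASURABLE `{x | P (w₁ x) x}` (`c₀ ≥ 1`, binder `hSieg`; the Siegel height match §1 a.e. +
DOWN §3). [cite: BernsteinLapid2019, §4 (p. 10)] [cite: Garrett2018, §2.3] -/
theorem ae_restrict_of_ae_weightedTruncMeasure
    (hSieg : ∀ γ : (quasiSplit F E c N).arithmeticSubgroup, γ ∉ arithmeticBorel F E c N → ∀ g : (quasiSplit F E c N).Adelic,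
      1 < borelHeight g → borelHeight ((γ : (quasiSplit F E c N).Adelic) * g) < 1)
    (k : ℕ) {c₀ : ℝ≥0} (hc₀ : 1 ≤ c₀) {P : ℝ≥0 → (quasiSplit F E c N).automorphicQuotient → Prop}
    (hP : MeasurableSet {x | P (supHeight F E c N x) x})
    (h : ∀ᵐ z ∂(weightedTruncMeasure F E c N k c₀ μZ), P (borelQuotHeight F E c N z) (pZX F E c N z)) :
    ∀ᵐ x ∂(μ.restrict {x | c₀ < supHeight F E c N x}), P (supHeight F E c N x) x := by
  refine ae_restrict_of_ae_comp_pZX μ νG hβ hμZ k c₀ (Q := fun x => P (supHeight F E c N x) x) hP ?_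
  filter_upwards [h, ae_supHeight_pZX_eq hSieg k hc₀ μZ] with z hz heq
  rw [heq]
  exact hz

end Transport

/-! ### §4′ The Siegel binder discharged at `N = 2` and `N = 3` -/

section TransportTwoThree

variable {F E : Type} [Field F] [NumberField F] [Field E] [NumberField E] [Algebra F E] {c : E ≃ₐ[F] E}

/-- `N = 2`: **`(∀ᵐ x ∂μ|_{{c₀<w₁}}, P (w₁ x) x) → ∀ᵐ z ∂wtm_{k,c₀}, P (HZ z) (p z)`**, `c₀ ≥ 1`, letter-free (★ big cell at `N = 2`). [cite: BernsteinLapid2019, §4 (p. 10)] [cite: Garrett2018, §2.3] -/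
theorem ae_weightedTruncMeasure_of_ae_restrict_two [MeasurableSpace (quasiSplit F E c 2).Adelic] [BorelSpace (quasiSplit F E c 2).Adelic]
    (μ : Measure (quasiSplit F E c 2).automorphicQuotient) [(quasiSplit F E c 2).IsAutomorphicMeasure μ]
    (νG : Measure (quasiSplit F E c 2).Adelic) [νG.IsHaarMeasure] [νG.IsInvInvariant]
    {β : (quasiSplit F E c 2).Adelic → ℝ≥0∞} (hβ : IsCoveringWeight ↥((arithmeticBorel F E c 2).map (quasiSplit F E c 2).arithmeticSubgroup.subtype) β)
    {μZ : Measure (borelQuotient F E c 2)} (hμZ : ∀ f : borelQuotient F E c 2 → ℝ≥0∞, Measurable f → ∫⁻ z, f z ∂μZ = ∫⁻ g, β g * f (toBorelQuotient F E c 2 g) ∂νG)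
    (k : ℕ) {c₀ : ℝ≥0} (hc₀ : 1 ≤ c₀) {P : ℝ≥0 → (quasiSplit F E c 2).automorphicQuotient → Prop}
    (h : ∀ᵐ x ∂(μ.restrict {x | c₀ < supHeight F E c 2 x}), P (supHeight F E c 2 x) x) :
    ∀ᵐ z ∂(weightedTruncMeasure F E c 2 k c₀ μZ), P (borelQuotHeight F E c 2 z) (pZX F E c 2 z) :=
  ae_weightedTruncMeasure_of_ae_restrict μ νG hβ hμZ (fun _ hγ _ hg => borelHeight_mul_lt_one_of_not_mem_arithmeticBorel_two hγ hg) k hc₀ h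

/-- `N = 2`: **`(∀ᵐ z ∂wtm_{k,c₀}, P (HZ z) (p z)) → ∀ᵐ x ∂μ|_{{c₀<w₁}}, P (w₁ x) x`** for measurable `{x | P (w₁ x) x}`, `c₀ ≥ 1`, letter-free. [cite: BernsteinLapid2019, §4 (p. 10)] [cite: Garrett2018, §2.3] -/
theorem ae_restrict_of_ae_weightedTruncMeasure_two [MeasurableSpace (quasiSplit F E c 2).Adelic] [BorelSpace (quasiSplit F E c 2).Adelic]
    (μ : Measure (quasiSplit F E c 2).automorphicQuotient) [(quasiSplit F E c 2).IsAutomorphicMeasure μ]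
    (νG : Measure (quasiSplit F E c 2).Adelic) [νG.IsHaarMeasure] [νG.IsInvInvariant]
    {β : (quasiSplit F E c 2).Adelic → ℝ≥0∞} (hβ : IsCoveringWeight ↥((arithmeticBorel F E c 2).map (quasiSplit F E c 2).arithmeticSubgroup.subtype) β)
    {μZ : Measure (borelQuotient F E c 2)} (hμZ : ∀ f : borelQuotient F E c 2 → ℝ≥0∞, Measurable f → ∫⁻ z, f z ∂μZ = ∫⁻ g, β g * f (toBorelQuotient F E c 2 g) ∂νG)
    (k : ℕ) {c₀ : ℝ≥0} (hc₀ : 1 ≤ c₀) {P : ℝ≥0 → (quasiSplit F E c 2).automorphicQuotient → Prop}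
    (hP : MeasurableSet {x | P (supHeight F E c 2 x) x})
    (h : ∀ᵐ z ∂(weightedTruncMeasure F E c 2 k c₀ μZ), P (borelQuotHeight F E c 2 z) (pZX F E c 2 z)) :
    ∀ᵐ x ∂(μ.restrict {x | c₀ < supHeight F E c 2 x}), P (supHeight F E c 2 x) x :=
  ae_restrict_of_ae_weightedTruncMeasure μ νG hβ hμZ (fun _ hγ _ hg => borelHeight_mul_lt_one_of_not_mem_arithmeticBorel_two hγ hg) k hc₀ hP h

/-- `N = 3`: **`(∀ᵐ x ∂μ|_{{c₀<w₁}}, P (w₁ x) x) → ∀ᵐ z ∂wtm_{k,c₀}, P (HZ z) (p z)`**, `c₀ ≥ 1`, letter-free (★ big cell at `N = 3`). [cite: BernsteinLapid2019, §4 (p. 10)] [cite: Rogawski1990, §2.2 p. 13] -/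
theorem ae_weightedTruncMeasure_of_ae_restrict_three [MeasurableSpace (quasiSplit F E c 3).Adelic] [BorelSpace (quasiSplit F E c 3).Adelic]
    (μ : Measure (quasiSplit F E c 3).automorphicQuotient) [(quasiSplit F E c 3).IsAutomorphicMeasure μ]
    (νG : Measure (quasiSplit F E c 3).Adelic) [νG.IsHaarMeasure] [νG.IsInvInvariant]
    {β : (quasiSplit F E c 3).Adelic → ℝ≥0∞} (hβ : IsCoveringWeight ↥((arithmeticBorel F E c 3).map (quasiSplit F E c 3).arithmeticSubgroup.subtype) β)
    {μZ : Measure (borelQuotient F E c 3)} (hμZ : ∀ f : borelQuotient F E c 3 → ℝ≥0∞, Measurable f → ∫⁻ z, f z ∂μZ = ∫⁻ g, β g * f (toBorelQuotient F E c 3 g) ∂νG)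
    (k : ℕ) {c₀ : ℝ≥0} (hc₀ : 1 ≤ c₀) {P : ℝ≥0 → (quasiSplit F E c 3).automorphicQuotient → Prop}
    (h : ∀ᵐ x ∂(μ.restrict {x | c₀ < supHeight F E c 3 x}), P (supHeight F E c 3 x) x) :
    ∀ᵐ z ∂(weightedTruncMeasure F E c 3 k c₀ μZ), P (borelQuotHeight F E c 3 z) (pZX F E c 3 z) :=
  ae_weightedTruncMeasure_of_ae_restrict μ νG hβ hμZ (fun _ hγ _ hg => borelHeight_mul_lt_one_of_not_mem_arithmeticBorel hγ hg) k hc₀ h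

/-- `N = 3`: **`(∀ᵐ z ∂wtm_{k,c₀}, P (HZ z) (p z)) → ∀ᵐ x ∂μ|_{{c₀<w₁}}, P (w₁ x) x`** for measurable `{x | P (w₁ x) x}`, `c₀ ≥ 1`, letter-free. [cite: BernsteinLapid2019, §4 (p. 10)] [cite: Rogawski1990, §2.2 p. 13] -/
theorem ae_restrict_of_ae_weightedTruncMeasure_three [MeasurableSpace (quasiSplit F E c 3).Adelic] [BorelSpace (quasiSplit F E c 3).Adelic]
    (μ : Measure (quasiSplit F E c 3).automorphicQuotient) [(quasiSplit F E c 3).IsAutomorphicMeasure μ]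
    (νG : Measure (quasiSplit F E c 3).Adelic) [νG.IsHaarMeasure] [νG.IsInvInvariant]
    {β : (quasiSplit F E c 3).Adelic → ℝ≥0∞} (hβ : IsCoveringWeight ↥((arithmeticBorel F E c 3).map (quasiSplit F E c 3).arithmeticSubgroup.subtype) β)
    {μZ : Measure (borelQuotient F E c 3)} (hμZ : ∀ f : borelQuotient F E c 3 → ℝ≥0∞, Measurable f → ∫⁻ z, f z ∂μZ = ∫⁻ g, β g * f (toBorelQuotient F E c 3 g) ∂νG)
    (k : ℕ) {c₀ : ℝ≥0} (hc₀ : 1 ≤ c₀) {P : ℝ≥0 → (quasiSplit F E c 3).automorphicQuotient → Prop}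
    (hP : MeasurableSet {x | P (supHeight F E c 3 x) x})
    (h : ∀ᵐ z ∂(weightedTruncMeasure F E c 3 k c₀ μZ), P (borelQuotHeight F E c 3 z) (pZX F E c 3 z)) :
    ∀ᵐ x ∂(μ.restrict {x | c₀ < supHeight F E c 3 x}), P (supHeight F E c 3 x) x :=
  ae_restrict_of_ae_weightedTruncMeasure μ νG hβ hμZ (fun _ hγ _ hg => borelHeight_mul_lt_one_of_not_mem_arithmeticBorel hγ hg) k hc₀ hP h

end TransportTwoThree

end Summit.HodgeConjecture.HodgeConjecture.Cruxes.H413.K2E1BLSiegelTransportU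

end
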